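import Summits.Ventures.PercRepro.RankLevelSetHallFlatLym

/-!
# PercRepro — THE EQUAL-SPLIT KERNEL AT THE TIGHT LAYER: LOADS ≤ 1, DOMINATION OF THE FLAT-LYM KERNEL, AND THE TRANSFER
TO THE UP-HALL FORM (p4, gen 38; paper proofs/P4-KERNEL-A-DEAD.md §4; C-044, UP form, tight layer `#E = p + q`, any `k`)

The simplest rule of all: **every `Y`-set `S` splits one unit equally among the members inside it** (`eqMembers`,
`eqWeight = 1 / #eqMembers S`).  THIS FILE: the weight is non-negative, supported on `Z ⊆ S`, every `Y`-set is loaded at most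
`1` (`eqWeight_load_le_one` — exactly `1` when `S` contains a member; no tight-layer hypothesis needed), and the weight
**dominates the flat-LYM weight** pointwise (`flWeight_le_eqWeight`: the members inside `S` are partitioned by their closure
flat `G`, each class having at most `C(#(S ∩ G), q)` elements, so `#eqMembers S ≤ Λ(S)`).  Hence `FlatLymRecv ⇒ EqSplitRecv`
(`eqSplitRecv_of_flatLymRecv`), and `EqSplitRecv M p q` (a `Prop`, NOT asserted: every member receives at least `Φ(p,q)`)
gives the UP-Hall condition for every family (`hallUp_of_eqSplit`).  Census (p4 g38, own exact code): min receipt/Φ = 1 on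
the random census (`n ≤ 12`, `k ≤ 5`) and ≥ 1.11 on the structured instances incl. the family refuting kernel A; level by level
as well (receipt at rank `q + t` ≥ `C(p,t)/C(q+t,t)`).  NOT proved.

* `eqMembers`, `eqMembers_finite`, `eqWeight`;
* `eqWeight_nonneg`, `subset_of_eqWeight_ne_zero`, **`eqWeight_load_le_one`**;
* **`flWeight_le_eqWeight`**, `EqSplitRecv`, `eqSplitRecv_of_flatLymRecv`, **`hallUp_of_eqSplit`**.
Axioms: standard.
-/

namespace PercRepro

open Set Matroid Finset

variable {α : Type} (M : Matroid α) [M.Finite]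

/-- The members inside `S`. -/
def eqMembers (p q : ℕ) (S : Set α) : Set (Set α) := {Z | Z ∈ cellMembers M p q ∧ Z ⊆ S}

/-- The members inside `S` form a finite family. -/
theorem eqMembers_finite (p q : ℕ) (S : Set α) : (eqMembers M p q S).Finite :=
  (cellMembers_finite M p q).subset (fun _ hZ => hZ.1)

/-- **The equal-split weight** of the member `Z` at the `Y`-set `S`: `1 / #eqMembers S` when `Z ⊆ S`, `0` otherwise. -/
noncomputable def eqWeight (p q : ℕ) (Z S : Set α) : ℚ := by
  classical
  exact if Z ∈ cellMembers M p q ∧ Z ⊆ S ∧ S ∈ cellY M p q then 1 / ((eqMembers M p q S).ncard : ℚ) else 0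

omit [M.Finite] in
/-- The weight is non-negative. -/
theorem eqWeight_nonneg (p q : ℕ) (Z S : Set α) : 0 ≤ eqWeight M p q Z S := by
  classical
  unfold eqWeight
  split_ifs <;> positivity

omit [M.Finite] in
/-- The weight is supported on the pairs `Z ⊆ S`. -/
theorem subset_of_eqWeight_ne_zero (p q : ℕ) (Z S : Set α) (h : eqWeight M p q Z S ≠ 0) : Z ⊆ S := by
  classical
  by_contra hZS
  apply h
  unfold eqWeight
  rw [if_neg (fun hc => hZS hc.2.1)]

open Classical in
/-- The members inside `S`, as a finset of the finset of members: the filter `Z ⊆ S`. -/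
theorem ncard_eqMembers_eq (p q : ℕ) (S : Set α) :
    (eqMembers M p q S).ncard = ((cellMembers_finite M p q).toFinset.filter (fun Z => Z ⊆ S)).card := by
  classical
  have heq : eqMembers M p q S
      = (((cellMembers_finite M p q).toFinset.filter (fun Z => Z ⊆ S) : Finset (Set α)) : Set (Set α)) := by
    ext Z
    rw [Finset.coe_filter, Set.mem_setOf_eq, (cellMembers_finite M p q).mem_toFinset]
    rfl
  rw [heq, ncard_coe_finset]

/-- **Every `Y`-set is loaded at most `1`** (exactly `1` when it contains a member). -/
theorem eqWeight_load_le_one (p q : ℕ) {S : Set α} (hS : S ∈ cellY M p q) :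
    ∑ Z ∈ (cellMembers_finite M p q).toFinset, eqWeight M p q Z S ≤ 1 := by
  classical
  set Mf : Finset (Set α) := (cellMembers_finite M p q).toFinset with hMf
  have hmemM : ∀ Z, Z ∈ Mf ↔ Z ∈ cellMembers M p q := fun Z => by
    rw [hMf, (cellMembers_finite M p q).mem_toFinset]
  have hw : ∀ Z ∈ Mf, eqWeight M p q Z S = if Z ⊆ S then 1 / ((eqMembers M p q S).ncard : ℚ) else 0 := by
    intro Z hZ
    rw [hmemM] at hZ
    unfold eqWeight
    by_cases hZS : Z ⊆ S
    · rw [if_pos ⟨hZ, hZS, hS⟩, if_pos hZS]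
    · rw [if_neg (fun hc => hZS hc.2.1), if_neg hZS]
  rw [Finset.sum_congr rfl hw, Finset.sum_ite, Finset.sum_const_zero, add_zero, Finset.sum_const, nsmul_eq_mul,
    ncard_eqMembers_eq]
  by_cases h0 : (Mf.filter (fun Z => Z ⊆ S)).card = 0
  · rw [h0]; simp
  · have hpos : (0 : ℚ) < ((Mf.filter (fun Z => Z ⊆ S)).card : ℚ) := by exact_mod_cast Nat.pos_of_ne_zero h0
    rw [mul_one_div, div_self hpos.ne']

/-- **The equal-split weight dominates the flat-LYM weight**: `#eqMembers S ≤ Λ(S)` at the tight layer (the members inside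
`S` partitioned by closure flat, each class a family of `q`-subsets of `S ∩ G`). -/
theorem flWeight_le_eqWeight (p q : ℕ) (hE : M.E.ncard = p + q) (Z S : Set α) :
    flWeight M p q Z S ≤ eqWeight M p q Z S := by
  classical
  unfold flWeight eqWeight
  by_cases hc : Z ∈ cellMembers M p q ∧ Z ⊆ S ∧ S ∈ cellY M p q
  · rw [if_pos hc, if_pos hc]
    obtain ⟨hZ, hZS, hS⟩ := hc
    -- #eqMembers S ≤ Λ(S): the load bound of the flat-LYM kernel, read off
    have hload := flWeight_load_le_one M p q hE hS
    have hw : ∀ Z' ∈ (cellMembers_finite M p q).toFinset,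
        flWeight M p q Z' S = if Z' ⊆ S then 1 / lymFlatSum M p q S else 0 := by
      intro Z' hZ'
      rw [(cellMembers_finite M p q).mem_toFinset] at hZ'
      unfold flWeight
      by_cases hZ'S : Z' ⊆ S
      · rw [if_pos ⟨hZ', hZ'S, hS⟩, if_pos hZ'S]
      · rw [if_neg (fun hc => hZ'S hc.2.1), if_neg hZ'S]
    rw [Finset.sum_congr rfl hw, Finset.sum_ite, Finset.sum_const_zero, add_zero, Finset.sum_const, nsmul_eq_mul,
      ← ncard_eqMembers_eq] at hload
    have hΛ : 1 ≤ lymFlatSum M p q S := lymFlatSum_pos M p q hE hZ hZS hS.1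
    have hm : (0 : ℚ) < ((eqMembers M p q S).ncard : ℚ) := by
      have hne : (eqMembers M p q S).Nonempty := ⟨Z, hZ, hZS⟩
      have := (Set.ncard_pos (eqMembers_finite M p q S)).2 hne
      exact_mod_cast this
    rw [mul_one_div, div_le_one (by linarith)] at hload
    exact one_div_le_one_div_of_le hm hload
  · rw [if_neg hc, if_neg hc]

/-- **The equal-split receipt condition** (a `Prop`, NOT asserted): every member receives at least `Φ(p,q)` under the
equal-split kernel.  The candidate of record for `k ≥ 3` (it dominates the flat-LYM kernel). -/
def EqSplitRecv (p q : ℕ) : Prop :=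
  ∀ Z ∈ cellMembers M p q, phiK p q ≤ ∑ S ∈ (cellY_finite M p q).toFinset, eqWeight M p q Z S

/-- `FlatLymRecv` implies `EqSplitRecv` at the tight layer (pointwise domination). -/
theorem eqSplitRecv_of_flatLymRecv (p q : ℕ) (hE : M.E.ncard = p + q) (h : FlatLymRecv M p q) : EqSplitRecv M p q := by
  intro Z hZ
  calc phiK p q ≤ ∑ S ∈ (cellY_finite M p q).toFinset, flWeight M p q Z S := h Z hZ
    _ ≤ ∑ S ∈ (cellY_finite M p q).toFinset, eqWeight M p q Z S :=
        Finset.sum_le_sum (fun S _ => flWeight_le_eqWeight M p q hE Z S)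

/-- **THE TRANSFER**: `EqSplitRecv M p q` gives the UP-Hall condition for every family of members (through night-1's
`hallUp_of_fracMatching`; no tight-layer hypothesis is needed for the loads). -/
theorem hallUp_of_eqSplit (p q : ℕ) (h : EqSplitRecv M p q) (𝒜 : Set (Set α)) (h𝒜 : 𝒜 ⊆ cellMembers M p q) :
    phiK p q * (𝒜.ncard : ℚ) ≤ ((upNbhd M p q 𝒜).ncard : ℚ) :=
  hallUp_of_fracMatching M p q (eqWeight M p q) (eqWeight_nonneg M p q) (subset_of_eqWeight_ne_zero M p q)
    (fun _ hZ => h _ hZ) (fun _ hS => eqWeight_load_le_one M p q hS) 𝒜 h𝒜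

end PercRepro
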